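import Literature.AnabelianGeometry.EtaleTheta.Discharge.Sec4NonVacuityProp42iv
import Literature.AnabelianGeometry.EtaleTheta.Prop42Sub
import HarnessLib

/-!
# [EtTh] §4: at the cover-free, constant-free toy the covering input L01a itself FAILS — the obstruction is
# `μ_N`-saturation, i.e. the absence of constants (negative companion of `ToyCov`/`ToyCovZ`)

S. Mochizuki, *The étale theta function and its Frobenioid-theoretic manifestations*, Publ. RIMS **45**
(2009) [MochizukiEtTh2009], §4, Def 4.1 (iv)(a) p.87 ("`A` is … `μ_N`-saturated"), Prop 4.2 (iii) p.88 and
its proof p.89 (ERRATUM E2; sub-node L01a `RootOverCovering` of `plan/L2/SUBDAG-EtTh-Prop42.md`); [FrdII]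
Def 2.1 (i) ("`μ_N(A) ≅ ℤ/Nℤ`").

PROOF-ONLY complement to this seat's §4 toy series, answering the second clause of abc-iut-L2-lead's row «§4 TOY
WITH A COVERING» (R75: "… or the certificate that no [such] toy can carry L01a, with the obstruction named").
At `Toy.biKummerSetting` (p418516; `B = t^ℤ`, no constants, no covers) every unit group `O^×(A)` is trivial
(`Toy.eq_one_of_mem_units'`, p423740), hence NO object is `μ_N`-saturated for `N ≥ 2`
(`Toy.not_isMuSaturated`), hence the typed covering input L01a `RootOverCovering` — which asks for a
`μ_N`-saturated covering object — is FALSE there for every transport (`Toy.not_rootOverCovering`), and so is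
L01′.  THE OBSTRUCTION NAMED: not the lack of covers but the lack of CONSTANTS (roots of unity in `O^×`); it is
exactly what the Kummer-tower toys add (`ToyCov.isMuSaturated`, p427822; `ToyCovZ`, p429761), where L01a and
Prop 4.2 (iii) then hold (p428415, p429911).  More generally (`not_isMuSaturated_of_units_trivial`): in ANY
§4 setting an object with trivial unit group is not `μ_N`-saturated for `N ≥ 2`.  Nothing here bears on, or takes
a side on, [IUTchIII] Cor. 3.12.
-/

noncomputable section

namespace Literature.AnabelianGeometry.EtaleTheta

open CategoryTheory Opposite Literature.AlgebraicGeometry.Frobenioids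
open scoped NNRat

namespace BiKummerSetting

universe u₀ v₀ u v w

variable {K : Type u₀} [Field K] {X : SemiGraphs.TemperedArithmeticGroup.{u₀} K} {D₀ : Type u₀}
  [Category.{v₀} D₀] {V : FrdIMonoidStub.{w}} {T : RealifiedDivisorMonoids (D₀ := D₀) V} {D : Type u}
  [Category.{v} D] {VD : FrdICatStub.{u, v, w} D} (S : BiKummerSetting X T D VD)

/-- **The obstruction, in general**: in any §4 setting, an object ALL of whose units are trivial is not
`μ_N`-saturated for `N ≥ 2` ([FrdII] Def 2.1 (i) asks for an element of order `N` in `μ_N(A) ⊆ O^×(A)`).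
[cite: MochizukiEtTh2009, Def 4.1 p.87] -/
theorem not_isMuSaturated_of_units_trivial {A : S.C} (hA : ∀ σ ∈ S.units A, σ = 1) {N : ℕ+}
    (hN : 2 ≤ (N : ℕ)) : ¬ S.IsMuSaturated A N := by
  rintro ⟨σ, ⟨hσu, -⟩, hord, -⟩
  rw [hA σ hσu, orderOf_one] at hord
  omega

end BiKummerSetting

namespace Toy

/-- **No object of the cover-free toy is `μ_N`-saturated for `N ≥ 2`** (all unit groups are trivial,
`eq_one_of_mem_units'`). [cite: MochizukiEtTh2009, Def 4.1 p.87] -/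
theorem not_isMuSaturated (A : biKummerSetting.C) {N : ℕ+} (hN : 2 ≤ (N : ℕ)) :
    ¬ biKummerSetting.IsMuSaturated A N :=
  biKummerSetting.not_isMuSaturated_of_units_trivial (fun _ hσ => eq_one_of_mem_units' hσ) hN

/-- **L01a `RootOverCovering` FAILS at the cover-free toy, for EVERY transport `pullFrac`** — already at
`N = 2`, `f = 1`: the sub-node asks for a `μ_2`-saturated covering object, and the toy has none.  So what a toy
must add to carry L01a is CONSTANTS in `O^×` (roots of unity), as in `ToyCov`/`ToyCovZ`.
[cite: MochizukiEtTh2009, Prop 4.2 p.89] -/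
theorem not_rootOverCovering
    (pullFrac : ∀ {A A' : biKummerSetting.C} (_ : A' ⟶ A),
      biKummerSetting.biratUnits A → biKummerSetting.biratUnits A') :
    ¬ BiKummerSetting.Prop42Sub.RootOverCovering biKummerSetting pullFrac := by
  intro h
  obtain ⟨A', -, -, -, -, hμ, -⟩ := h 2 1
  exact not_isMuSaturated A' (le_refl 2) hμ

/-- Likewise **L01′ `SaturatedRootCoverInSkeleton` FAILS at the cover-free toy**, for every transport.
[cite: MochizukiEtTh2009, Prop 4.2 p.89] -/
theorem not_saturatedRootCoverInSkeleton
    (pullFrac : ∀ {A A' : biKummerSetting.C} (_ : A' ⟶ A),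
      biKummerSetting.biratUnits A → biKummerSetting.biratUnits A') :
    ¬ BiKummerSetting.Prop42Sub.SaturatedRootCoverInSkeleton biKummerSetting pullFrac := by
  intro h
  obtain ⟨A', -, -, -, -, -, hμ, -⟩ := h 2 1
  exact not_isMuSaturated A' (le_refl 2) hμ

end Toy

end Literature.AnabelianGeometry.EtaleTheta

end
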